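import Literature.Computability.AlgebraicComplexity.BI17NonNormalOrbitClosuresProofs
import Literature.Computability.AlgebraicComplexity.BI17FormPolystabilityCriterion
import Literature.Computability.AlgebraicComplexity.BI17GenericMinimalDegreeProofs
import Literature.Computability.AlgebraicComplexity.BI17GenericDegreeMonoidProofs
import Literature.Computability.AlgebraicComplexity.BI17GenericTernaryQuarticPeriod
import Mathlib.RingTheory.Polynomial.Cyclotomic.Basic
import Mathlib.RingTheory.RootsOfUnity.Complex
import Mathlib.Algebra.MvPolynomial.Nilpotent
import HarnessLib

/-!
# Bürgisser–Ikenmeyer 2017, Cor. 3.17 (2) for the formats `(D, m) = (k m, m)`, `k` even — PROOFS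
# without Prop. 2.10 (generic polystability): the forms twin of the tensor witness argument

P. Bürgisser, C. Ikenmeyer, *Fundamental invariants of orbit closures*, J. Algebra **477** (2017)
390–434 = arXiv:1511.02927 [BurgisserIkenmeyer2017], Cor. 3.17 (2) (TeX L1170–1178): "Suppose that
`a'(D,m) = 1` and let `w ∈ Sym^D ℂ^m` be generic. Then `\overline{Gw}` is not normal if `D` is odd, or
if `D` is even and `gcd(D,m) > 1`." THEOREMS ONLY; sibling of the statement file
`BI17FundamentalInvariantForms.lean` (val-lit row BI2017-A), whose named fact `BI2017_cor_3_17`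
is NOT restated and stays a named fact (its part 1 is the tree's `BI2017_cor_3_17_1`; its part 2 so
far rests on Prop. 2.10 by `BI2017_cor_3_17_of_prop_2_10`). No new definition, no new named fact.

The printed proof of part 2 uses generic polystability (Prop. 2.10 = Luna's étale slices +
Thm. 2.3; the open named fact `BI2017_prop_2_10`). As for tensors
(`BI17GenericPeriodPolystableWitnessProofs.lean`), polystability of the generic form can be traded
for ONE explicit polystable witness and the Reynolds-free core of the non-normality theorem:

## What is proved (ours, not in print)

* `not_isIntegrallyClosed_orbitCoordRing_of_consecutive` — the ALGEBRAIC core of Thm. 3.10 (the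
  forms twin of the tree's tensor lemma `not_isIntegrallyClosed_tensorOrbitCoordRing_of_consecutive`):
  `k, k+1 ∈ E'(w)`, `k ≥ 1`, `1 ∉ E'(w)` ⇒ `O(\overline{Gw})` is not integrally closed. No
  polystability.
* `mul_mem_degreeMonoid_of_mem_exponentMonoid` — `b(w) e ∈ E(w)` for `e ∈ E'(w)` for EVERY nonzero
  form (the `⊇` half of Lemma 3.2 (3) without its polystability hypothesis; complete reducibility of
  `ℂ[Sym^D]` under `GL_m`, as in the tree's `BI2017_lem_3_2_3_holds`).
* `exists_mem_degreeMonoid_add_degreePeriod` — for every polystable `w ≠ 0`: `q, q + b(w) ∈ E(w)`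
  for some `q` (the discharged Thm. 3.4 `BI2017_thm_3_4_holds` + primality of `I(Gw)`).
* `stabilizerPeriod_prod_X_pow` — **`a((X_1⋯X_m)^k) = k` for even `k ≥ 2`, `m ≥ 2`** (from the
  discharged Prop. 2.4 (1), `a(X_1⋯X_m) = 2`, and `vᵏ = uᵏ ⇒ v = ζ u`); hence `b((X_1⋯X_m)^k) = 1`
  in degree `D = k m`, and the witness is polystable (`isPolystable_prod_X_pow`, t09).
* **`BI2017_cor_3_17_part2_of_mul_even`** — Cor. 3.17 (2) at `(D, m) = (k m, m)`, `k ≥ 2` even,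
  `m ≥ 2` (`D` even, `gcd(D,m) = m > 1`): if almost all `w` have `a'(w) = 1`, then almost all `w`
  have a NON-normal orbit closure. Proof: `E((X_1⋯X_m)^k)` generates `ℤ`, so `E(D,m)` contains
  consecutive degrees `q, q+1` (nonzero invariants `F_q, F_{q+1}`); off `{F_q F_{q+1} = 0}` a form
  with `a'(w) = 1` has `b(w) = 1`, `a(w) = k` (`degreePeriod_eq_div_gcd_of_reducedStabilizerPeriod_eq_one`,
  eq. (3.1)), `q, q+1 ∈ E'(w)` (exact semi-invariance), `1 ∉ E'(w)` and `q ≥ 1` (else `1 ∈ E(D,m)`,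
  but `e(D,m) = m ≥ 2`, Cor. 3.16 = `BI2017_cor_3_16_holds`); the core concludes.
  `BI2017_cor_3_17_part2_four_two` records the first instance (binary quartics).

* (v2) **`isZariskiGeneric_period_of_mul_even`** — BI Thm. 2.3's generic period ON THE RANGE
  `D = k m`, `k ≥ 2` even, `m ≥ 2`, PROVED: almost all `w ∈ Sym^{km} ℂ^m` have `a(w) = k` and
  `a'(w) = 1` (`det(stab w) ≤ μ_{kq} ∩ μ_{k(q+1)} = μ_k` off `{F_q F_{q+1} = 0}` by exact
  semi-invariance, `⊇ μ_k` by the scalar matrices); instances `BI2017_thm_2_3_period_of_mul_even` of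
  the typed-verbatim fact's clause (the printed exceptions `(3,2), (3,3), (4,3)` are outside this
  range). Hence **`isZariskiGeneric_not_isIntegrallyClosed_of_mul_even`: Cor. 3.17 (2) at
  `(k m, m)`, `k` even, holds UNCONDITIONALLY** — almost all forms of degree `k m` in `m ≥ 2`
  variables have a non-normal `GL_m`-orbit closure (the instance `(4, 2)` was already in the tree,
  `BI2017_cor_3_17_2_four_two`, by another route).

* (v3) **Witness-free reduction to TWO INVARIANT DEGREES** (`isZariskiGeneric_period_of_invariants`,
  `isZariskiGeneric_not_isIntegrallyClosed_of_invariants`): for ANY `D, m ≥ 2`, `g = gcd(D,m)`, if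
  `Sym^D ℂ^m` carries nonzero homogeneous `SL_m`-invariants of degrees `(m/g) t` and `(m/g)(t+1)`
  for some `t`, then almost all `w` have `a(w) = D/g`, `a'(w) = 1` (BI Thm. 2.3's value), and — if
  `D` is odd or `g > 1` — a non-normal orbit closure (Cor. 3.17 (2) at `(D,m)`, no Prop. 2.10).
  Inputs: `μ_{D/g} ≤ det(stab w)` for every form (`rootsOfUnity_div_gcd_le_stabilizerDetImage`,
  Lemma 2.1's scalar subgroup via Bezout), the weights `det^{(D/g)t}`, `det^{(D/g)(t+1)}`, Howe's
  bounds `le_of_mem_degreeMonoid` / `lt_of_mem_degreeMonoid_of_odd` for `1 ∉ E'(w)`. The `(k m, m)`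
  results above are the instances fed by the witness `(X_1⋯X_m)^k`.

Honest sizing of what remains of Cor. 3.17 (2): `D` odd, and `D` even with `m ∤ D` or `D/m` odd,
need other witnesses (a polystable form with `a'(w) = 1` and a computable stabilizer) — there the
named fact rests on Prop. 2.10 as in print.

Honest framing: typed-literature proofs for the cell `val-lit` (LADDER-VALIANT V3, a known-results
layer at a known separation); nothing here bears on VP versus VNP.

## References

* [BurgisserIkenmeyer2017] P. Bürgisser, C. Ikenmeyer, *Fundamental invariants of orbit closures*,
  J. Algebra 477 (2017) 390–434; arXiv:1511.02927, Prop. 2.4, Lemma 3.2, Thm. 3.4, Thm. 3.10,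
  Cor. 3.16, Cor. 3.17.
-/

noncomputable section

open MvPolynomial

namespace Literature.Computability.AlgebraicComplexity

/-! ### Arithmetic: differences of a numerical monoid (private) -/

section Arith

/-- If `x` lies in the subgroup of `ℤ` generated by an additive submonoid `S ⊆ ℕ`, then `x = p - q`
with `p, q ∈ S`. [folklore] -/
private theorem exists_sub_eq_of_mem_closure_image {S : Set ℕ} (h0 : 0 ∈ S)
    (hadd : ∀ {a b : ℕ}, a ∈ S → b ∈ S → a + b ∈ S) {x : ℤ}
    (hx : x ∈ AddSubgroup.closure ((fun d : ℕ => (d : ℤ)) '' S)) :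
    ∃ p ∈ S, ∃ q ∈ S, x = (p : ℤ) - q := by
  refine AddSubgroup.closure_induction (p := fun x _ => ∃ p ∈ S, ∃ q ∈ S, x = (p : ℤ) - q)
    ?_ ?_ ?_ ?_ hx
  · rintro y ⟨d, hd, rfl⟩
    exact ⟨d, hd, 0, h0, by simp⟩
  · exact ⟨0, h0, 0, h0, by simp⟩
  · rintro y z _ _ ⟨p, hp, q, hq, rfl⟩ ⟨p', hp', q', hq', rfl⟩
    exact ⟨p + p', hadd hp hp', q + q', hadd hq hq', by push_cast; ring⟩
  · rintro y _ ⟨p, hp, q, hq, rfl⟩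
    exact ⟨q, hq, p, hp, by ring⟩

end Arith

/-! ### Scalar matrices on `ℂ[Sym^D]` (private plumbing, as in `BI17DegreeExponentMonoidProofs`) -/

section Scalar

variable {ι : Type*} {d : ℕ}

/-- `aeval (c • X) (monomial s a) = c ^ |s| • monomial s a`. [folklore] -/
private theorem aeval_smul_X_monomial' (c : ℂ) (s : ι →₀ ℕ) (a : ℂ) :
    aeval (fun i => c • (X i : MvPolynomial ι ℂ)) (monomial s a) = c ^ s.degree • monomial s a := by
  classical
  have : ∀ i ∈ s.support, (c • (X i : MvPolynomial ι ℂ)) ^ s i = C (c ^ s i) * X i ^ s i := by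
    intro i _
    rw [smul_eq_C_mul, mul_pow, ← map_pow]
  rw [aeval_monomial, MvPolynomial.algebraMap_eq, Finsupp.prod, Finset.prod_congr rfl this,
    Finset.prod_mul_distrib, ← map_prod, Finset.prod_pow_eq_pow_sum, ← Finsupp.degree_apply,
    smul_eq_C_mul, monomial_eq, Finsupp.prod]
  ring

/-- Coefficients under the rescaling `X_i ↦ c X_i`: `coeff s (F(c X)) = c ^ |s| · coeff s F`. [folklore] -/
private theorem coeff_aeval_smul_X (c : ℂ) (F : MvPolynomial ι ℂ) (s : ι →₀ ℕ) :
    coeff s (aeval (fun i => c • (X i : MvPolynomial ι ℂ)) F) = c ^ s.degree * coeff s F := by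
  classical
  conv_lhs => rw [F.as_sum, map_sum]
  simp only [aeval_smul_X_monomial', coeff_sum, coeff_smul, coeff_monomial, smul_eq_mul, mul_ite,
    mul_zero]
  rw [Finset.sum_ite_eq']
  split_ifs with h
  · rfl
  · rw [notMem_support_iff.mp h, mul_zero]

variable {m D : ℕ}

/-- `(t • 1) · p = t ^ D • p` for a form `p` of degree `D`. [folklore] -/
private theorem linSubst_smul_one {p : MvPolynomial (Fin m) ℂ} (hp : p.IsHomogeneous D) (t : ℂ) :
    linSubst (Fin m) ℂ (t • (1 : Matrix (Fin m) (Fin m) ℂ)) p = t ^ D • p := by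
  rw [linSubst_smul_of_isHomogeneous hp, linSubst_one, AlgHom.id_apply]

/-- The matrix of the inverse scalar element `(t · 1)⁻¹ = t⁻¹ · 1`. [folklore] -/
private theorem coe_scalarGL_inv {t : ℂ} (ht : t ≠ 0) :
    (((Matrix.GeneralLinearGroup.scalar (Fin m) (Units.mk0 t ht))⁻¹ : GL (Fin m) ℂ) :
      Matrix (Fin m) (Fin m) ℂ) = t⁻¹ • (1 : Matrix (Fin m) (Fin m) ℂ) := by
  rw [← map_inv, Matrix.GeneralLinearGroup.coe_scalar, Matrix.scalar_apply,
    Matrix.smul_one_eq_diagonal, Units.val_inv_eq_inv_val, Units.val_mk0]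

/-- `det (t · 1) = t ^ m` in `ℂ`. [folklore] -/
private theorem val_det_scalarGL {t : ℂ} (ht : t ≠ 0) :
    ((Matrix.GeneralLinearGroup.det (Matrix.GeneralLinearGroup.scalar (Fin m) (Units.mk0 t ht)) :
      ℂˣ) : ℂ) = t ^ m := by
  rw [Matrix.GeneralLinearGroup.det_scalar, Units.val_pow_eq_pow_val, Units.val_mk0,
    Fintype.card_fin]

/-- The scalar element `t · 1` acts on the coordinate functions of `Sym^D` by `X_c ↦ t^{-D} X_c`.
[folklore] -/
private theorem coordSubst_scalarGL_X {t : ℂ} (ht : t ≠ 0) (c : DegIdx (Fin m) D) :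
    coordSubst D (Matrix.GeneralLinearGroup.scalar (Fin m) (Units.mk0 t ht)) (X c) =
      (t⁻¹) ^ D • (X c : MvPolynomial (DegIdx (Fin m) D) ℂ) := by
  classical
  rw [coordSubst_X]
  have h : ∀ e : DegIdx (Fin m) D,
      coeff c.1 (linSubstRep (Fin m) ℂ (Matrix.GeneralLinearGroup.scalar (Fin m) (Units.mk0 t ht))⁻¹
        (monomial e.1 1)) = if c = e then (t⁻¹) ^ D else 0 := by
    intro e
    rw [linSubstRep_apply, coe_scalarGL_inv ht,
      linSubst_smul_one (isHomogeneous_monomial (1 : ℂ) (mem_degMonomials_iff.mp e.2)) t⁻¹,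
      coeff_smul, coeff_monomial, smul_eq_mul, mul_ite, mul_one, mul_zero]
    by_cases hce : c = e
    · subst hce
      rw [if_pos rfl, if_pos rfl]
    · rw [if_neg hce, if_neg fun h => hce (Subtype.ext h.symm)]
  simp_rw [h, ite_smul, zero_smul]
  rw [Finset.sum_ite_eq Finset.univ c, if_pos (Finset.mem_univ _)]

/-- The scalar element `t · 1` acts on `ℂ[Sym^D]` as the rescaling `X_c ↦ t^{-D} X_c`. [folklore] -/
private theorem coordSubst_scalarGL_eq_aeval {t : ℂ} (ht : t ≠ 0) :
    coordSubst D (Matrix.GeneralLinearGroup.scalar (Fin m) (Units.mk0 t ht)) =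
      aeval fun c : DegIdx (Fin m) D => (t⁻¹) ^ D • (X c : MvPolynomial (DegIdx (Fin m) D) ℂ) :=
  MvPolynomial.algHom_ext fun c => by rw [coordSubst_scalarGL_X ht c, aeval_X]

end Scalar

/-! ### `b(w) e ∈ E(w)` for `e ∈ E'(w)`, for EVERY nonzero form (invariant lifting by complete reducibility) -/

section Lifting

variable {m D : ℕ} {f : MvPolynomial (Fin m) ℂ}

/-- **`E'(w) ⊆ E(w) / b(w)` for EVERY nonzero form `w`** (the `⊇` half of BI Lemma 3.2 (3),
`E(w) = b(w) E'(w)`, WITHOUT the polystability hypothesis): if a polynomial function `F` on `Sym^D`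
extends `φ_w^e`, i.e. `F(g w) = det(g)^{a(w) e}` for all `g ∈ GL_m`, then `b(w) e ∈ E(w)`. `F` is a
semi-invariant modulo the `GL`-stable ideal `I(Gw)`; `ℂ[Sym^D]` being a completely reducible
`GL_m`-module (`isSemisimpleRepresentation_coordRep`), the component of `F` in a stable complement is
an honest semi-invariant `z` with `z(w) = 1`, `SL_m`-invariant and homogeneous of degree `b(w) e`
(scalar matrices: `D · deg = m a(w) e = D b(w) e`, eq. (3.1)). The argument of the tree's
`BI2017_lem_3_2_3_holds`, verbatim, minus polystability. [cite: BurgisserIkenmeyer2017, Lemma 3.2 (3)] -/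
theorem mul_mem_degreeMonoid_of_mem_exponentMonoid (hD : 0 < D) (hf : f.IsHomogeneous D)
    (hf0 : f ≠ 0) {e : ℕ} (he : e ∈ exponentMonoid D f) :
    degreePeriod D f * e ∈ degreeMonoid D f := by
  classical
  -- `m = 0` is impossible: a nonzero form of positive degree needs a variable
  rcases Nat.eq_zero_or_pos m with hm0 | hm
  · subst hm0
    exact absurd (hf.inj_right (isHomogeneous_of_isEmpty (Fin 0) ℂ f) hf0) hD.ne'
  set a := stabilizerPeriod f with ha_def
  set b := degreePeriod D f with hb_def
  have hDb : D * b = m * a := BI2017_eq_3_1 hf hD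
  obtain ⟨F, hF⟩ := he
  -- the character `det^{-a e}` and the semi-invariance of `F` modulo `I(Gw)`
  set χ : GL (Fin m) ℂ → ℂ := fun g =>
    (((Matrix.GeneralLinearGroup.det g : ℂˣ) : ℂ))⁻¹ ^ (a * e) with hχ
  have hJ : ∀ g : GL (Fin m) ℂ,
      coordRep (Fin m) ℂ D g F - χ g • F ∈ orbitVanishingIdeal f D := by
    intro g
    rw [mem_orbitVanishingIdeal_iff]
    intro g'
    have h1 : aeval (formCoeff D (linSubstRep (Fin m) ℂ g' f)) (coordRep (Fin m) ℂ D g F) =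
        ((Matrix.GeneralLinearGroup.det (g⁻¹ * g') : ℂˣ) : ℂ) ^ (a * e) := by
      rw [coordRep_apply, aeval_formCoeff_coordSubst, ← Module.End.mul_apply, ← map_mul, hF]
    rw [map_sub, map_smul, h1, hF, smul_eq_mul, map_mul, map_inv, Units.val_mul,
      Units.val_inv_eq_inv_val, mul_pow, hχ, sub_self]
  -- a `GL`-stable complement of the vanishing ideal in `ℂ[Sym^D]`
  let Isub : Subrepresentation (coordRep (Fin m) ℂ D) :=
    ⟨(orbitVanishingIdeal f D).restrictScalars ℂ,
      fun g x hx => orbitVanishingIdeal_le_comap_coordSubst f D g hx⟩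
  obtain ⟨Csub, hC⟩ :=
    (isSemisimpleRepresentation_coordRep (σ := Fin m) (k := ℂ) D).exists_isCompl Isub
  have hC' : IsCompl Isub.toSubmodule Csub.toSubmodule :=
    ⟨by rw [disjoint_iff]; exact congrArg Subrepresentation.toSubmodule hC.1.eq_bot,
     by rw [codisjoint_iff]; exact congrArg Subrepresentation.toSubmodule hC.2.eq_top⟩
  obtain ⟨y, hy, z, hz, hyz⟩ :=
    Submodule.mem_sup.mp (hC'.sup_eq_top.symm ▸ Submodule.mem_top (x := F))
  have hyI : y ∈ orbitVanishingIdeal f D := hy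
  have hzF : z = F - y := by rw [← hyz]; abel
  -- `z` is an honest semi-invariant polynomial
  have hzsemi : ∀ g : GL (Fin m) ℂ, coordRep (Fin m) ℂ D g z = χ g • z := by
    intro g
    have h1 : coordRep (Fin m) ℂ D g z - χ g • z ∈ Csub.toSubmodule :=
      Csub.toSubmodule.sub_mem (Csub.apply_mem_toSubmodule g hz) (Csub.toSubmodule.smul_mem _ hz)
    have h2 : coordRep (Fin m) ℂ D g z - χ g • z ∈ Isub.toSubmodule := by
      have h3 : coordRep (Fin m) ℂ D g z - χ g • z =
          (coordRep (Fin m) ℂ D g F - χ g • F) - (coordRep (Fin m) ℂ D g y - χ g • y) := by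
        rw [hzF, map_sub, smul_sub]
        abel
      rw [h3]
      exact Isub.toSubmodule.sub_mem (hJ g)
        (Isub.toSubmodule.sub_mem (Isub.apply_mem_toSubmodule g hy)
          (Isub.toSubmodule.smul_mem _ hy))
    have h4 : coordRep (Fin m) ℂ D g z - χ g • z ∈ Isub.toSubmodule ⊓ Csub.toSubmodule :=
      ⟨h2, h1⟩
    rw [hC'.1.eq_bot] at h4
    exact sub_eq_zero.mp ((Submodule.mem_bot ℂ).mp h4)
  -- `z(w) = 1`
  have hF1 : aeval (formCoeff D f) F = 1 := by
    have h := hF 1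
    rwa [map_one, Module.End.one_apply, map_one, Units.val_one, one_pow] at h
  have hy0 : aeval (formCoeff D f) y = 0 := by
    have h := (mem_orbitVanishingIdeal_iff.mp hyI) 1
    rwa [map_one, Module.End.one_apply] at h
  have hz1 : aeval (formCoeff D f) z = 1 := by
    rw [hzF, map_sub, hF1, hy0, sub_zero]
  -- `z` is `SL`-invariant
  have hzSL : IsSLInvariantCoord D z := by
    intro h
    rw [hzsemi, hχ]
    simp only
    rw [Matrix.GeneralLinearGroup.val_det_apply, Matrix.SpecialLinearGroup.coe_GL_coe_matrix,
      h.det_coe, inv_one, one_pow, one_smul]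
  -- `z` is homogeneous of degree `b e`: compare the scalar matrix `2 · 1`
  have hzhom : z.IsHomogeneous (b * e) := by
    have h2 : (2 : ℂ) ≠ 0 := two_ne_zero
    intro s hs
    have hcoef := congrArg (coeff s)
      (hzsemi (Matrix.GeneralLinearGroup.scalar (Fin m) (Units.mk0 2 h2)))
    rw [coordRep_apply, coordSubst_scalarGL_eq_aeval h2, coeff_aeval_smul_X, coeff_smul, smul_eq_mul,
      hχ] at hcoef
    simp only at hcoef
    rw [val_det_scalarGL h2, ← inv_pow, ← pow_mul, ← pow_mul] at hcoef
    have hpow : ((2 : ℂ)⁻¹) ^ (D * s.degree) = ((2 : ℂ)⁻¹) ^ (m * (a * e)) :=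
      mul_right_cancel₀ hs hcoef
    rw [inv_pow, inv_pow, inv_inj] at hpow
    have hnat : D * s.degree = m * (a * e) := by
      have h' : ((2 ^ (D * s.degree) : ℕ) : ℂ) = ((2 ^ (m * (a * e)) : ℕ) : ℂ) := by
        push_cast
        exact hpow
      exact Nat.pow_right_injective le_rfl (Nat.cast_injective h')
    rw [← mul_assoc, ← hDb, mul_assoc] at hnat
    have hdeg : Finsupp.weight (1 : DegIdx (Fin m) D → ℕ) s = s.degree := by
      rw [Finsupp.degree_eq_weight_one]
      rfl
    rw [hdeg]
    exact Nat.eq_of_mul_eq_mul_left hD hnat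
  refine ⟨z, hzhom, hzSL, fun hzI => ?_⟩
  have h := (mem_orbitVanishingIdeal_iff.mp hzI) 1
  rw [map_one, Module.End.one_apply, hz1] at h
  exact one_ne_zero h

end Lifting

/-! ### The Reynolds-free core of Thm. 3.10 -/

section Core

variable {m D : ℕ}

/-- **BI 2017, Thm. 3.10, algebraic core — `\overline{Gw}` is not normal** as soon as the exponent
monoid `E'(w)` contains two consecutive positive integers `k, k+1` but not `1` (for ANY form `w`):
the fraction `F_{k+1}/F_k` of regular extensions of `φ_w^{k+1}`, `φ_w^k` is integral over
`O(\overline{Gw})` (`(F_{k+1}/F_k)^k = F_k`) but not in it (it would extend `φ_w`, forcing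
`1 ∈ E'(w)`). The forms twin of the tree's `not_isIntegrallyClosed_tensorOrbitCoordRing_of_consecutive`;
no polystability is assumed. [cite: BurgisserIkenmeyer2017, Thm. 3.10] -/
theorem not_isIntegrallyClosed_orbitCoordRing_of_consecutive (f : MvPolynomial (Fin m) ℂ) {k : ℕ}
    (hk0 : 0 < k) (hk : k ∈ exponentMonoid D f) (hk1 : k + 1 ∈ exponentMonoid D f)
    (h1 : 1 ∉ exponentMonoid D f) : ¬ IsIntegrallyClosed (OrbitCoordRing f D) := by
  classical
  intro hIC
  apply h1
  obtain ⟨F₁, hF₁⟩ := hk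
  obtain ⟨F₂, hF₂⟩ := hk1
  set a := stabilizerPeriod f with ha
  set I := orbitVanishingIdeal f D with hI
  haveI : IsDomain (OrbitCoordRing f D) := isDomain_orbitCoordRing f D
  set R := OrbitCoordRing f D
  set K := FractionRing (OrbitCoordRing f D)
  -- `F₁ ∉ I(Gw)` (`F₁(w) = 1`)
  have hF₁I : Ideal.Quotient.mk I F₁ ≠ 0 := by
    rw [Ne, Ideal.Quotient.eq_zero_iff_mem, hI, mem_orbitVanishingIdeal_iff, not_forall]
    refine ⟨1, ?_⟩
    rw [hF₁ 1]
    exact pow_ne_zero _ (Units.ne_zero _)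
  have hF₁K : algebraMap R K (Ideal.Quotient.mk I F₁) ≠ 0 := fun h =>
    hF₁I ((IsFractionRing.to_map_eq_zero_iff (R := R) (K := K)).1 h)
  -- `F₂^k = F₁^(k+1)` in `O(\overline{Gw})`
  have hpow : (Ideal.Quotient.mk I F₂) ^ k = (Ideal.Quotient.mk I F₁) ^ (k + 1) := by
    rw [← map_pow, ← map_pow, Ideal.Quotient.eq, hI, mem_orbitVanishingIdeal_iff]
    intro g
    rw [map_sub, map_pow, map_pow, hF₁ g, hF₂ g, ← pow_mul, ← pow_mul,
      show a * (k + 1) * k = a * k * (k + 1) by ring, sub_self]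
  -- `r = F₂ / F₁` is integral: `r ^ k = F₁`
  set r : K := algebraMap R K (Ideal.Quotient.mk I F₂) / algebraMap R K (Ideal.Quotient.mk I F₁)
    with hr
  have hrk : r ^ k = algebraMap R K (Ideal.Quotient.mk I F₁) := by
    rw [hr, div_pow, ← map_pow, hpow, map_pow, pow_succ, mul_comm, mul_div_assoc,
      div_self (pow_ne_zero _ hF₁K), mul_one]
  have hint : IsIntegral R (r ^ k) := by
    rw [hrk]
    exact isIntegral_algebraMap
  obtain ⟨y, hy⟩ := IsIntegrallyClosed.exists_algebraMap_eq_of_isIntegral_pow hk0 hint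
  obtain ⟨H, rfl⟩ := Ideal.Quotient.mk_surjective y
  -- `H F₁ ≡ F₂` modulo `I(Gw)`, so `H` extends `φ_w`: `1 ∈ E'(w)`
  have hHF : Ideal.Quotient.mk I H * Ideal.Quotient.mk I F₁ = Ideal.Quotient.mk I F₂ := by
    apply IsFractionRing.injective R K
    rw [map_mul, hy, hr, div_mul_cancel₀ _ hF₁K]
  refine ⟨H, fun g => ?_⟩
  rw [← map_mul, Ideal.Quotient.eq, hI, mem_orbitVanishingIdeal_iff] at hHF
  have := hHF g
  rw [map_sub, map_mul, hF₁ g, hF₂ g, sub_eq_zero, show a * (k + 1) = a * 1 + a * k by ring,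
    pow_add] at this
  exact mul_right_cancel₀ (pow_ne_zero _ (Units.ne_zero _)) this

end Core

/-! ### `q, q + b(w) ∈ E(w)` for every polystable form (Thm. 3.4) -/

section DegreeMonoidSucc

variable {m D : ℕ} {f : MvPolynomial (Fin m) ℂ}

/-- `E(w)` is closed under addition: `I(Gw)` is prime. [cite: BurgisserIkenmeyer2017, Def. 3.3] -/
theorem add_mem_degreeMonoid {d e : ℕ} (hd : d ∈ degreeMonoid D f) (he : e ∈ degreeMonoid D f) :
    d + e ∈ degreeMonoid D f := by
  obtain ⟨F, hFh, hFi, hFI⟩ := hd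
  obtain ⟨G, hGh, hGi, hGI⟩ := he
  refine ⟨F * G, hFh.mul hGh, hFi.mul hGi, fun h => ?_⟩
  rcases (orbitVanishingIdeal_isPrime f D).mem_or_mem h with h' | h'
  · exact hFI h'
  · exact hGI h'

/-- **Two invariant degrees differing by the degree period**, for EVERY polystable form `w ≠ 0` of
degree `D ≥ 2`: `q, q + b(w) ∈ E(w)` for some `q`. By the discharged Thm. 3.4
(`BI2017_thm_3_4_holds`: `E(w)` generates `b(w) ℤ`), `b(w) = p - q` with `p, q ∈ E(w)`.
[cite: BurgisserIkenmeyer2017, Thm. 3.4] -/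
theorem exists_mem_degreeMonoid_add_degreePeriod (hD : 2 ≤ D) (hf : f.IsHomogeneous D)
    (hf0 : f ≠ 0) (hpoly : IsPolystable f) :
    ∃ q : ℕ, q ∈ degreeMonoid D f ∧ q + degreePeriod D f ∈ degreeMonoid D f := by
  have hmem : ((degreePeriod D f : ℕ) : ℤ) ∈
      AddSubgroup.closure ((fun d : ℕ => (d : ℤ)) '' degreeMonoid D f) := by
    rw [BI2017_thm_3_4_holds m D f hD hf hf0 hpoly]
    exact AddSubgroup.mem_zmultiples _
  obtain ⟨p, hp, q, hq, hpq⟩ := exists_sub_eq_of_mem_closure_image (zero_mem_degreeMonoid f)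
    (fun ha hb => add_mem_degreeMonoid ha hb) hmem
  refine ⟨q, hq, ?_⟩
  have : p = q + degreePeriod D f := by omega
  rwa [← this]

end DegreeMonoidSucc


/-! ### The witness `(X_1⋯X_m)^k`: stabilizer period `k` (even `k`), degree period `1` in degree `k m` -/

section Witness

variable {m : ℕ}

/-- `k`-th roots in the domain `ℂ[X_1, …, X_m]`: `vᵏ = uᵏ` with `k ≥ 1` forces `v = c u` with
`cᵏ = 1` (`vᵏ - uᵏ = ∏_ζ (v - ζ u)` over the `k`-th roots of unity; units of `ℂ[X]` are constants).
[folklore] -/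
private theorem exists_smul_eq_of_pow_eq_pow {k : ℕ} (hk : 0 < k) {u v : MvPolynomial (Fin m) ℂ}
    (h : v ^ k = u ^ k) : ∃ c : ℂ, c ^ k = 1 ∧ v = c • u := by
  classical
  have hζ := (Complex.isPrimitiveRoot_exp k hk.ne').map_of_injective
    (MvPolynomial.C_injective (Fin m) ℂ)
  have hprod : ∏ ζ ∈ Polynomial.nthRootsFinset k (1 : MvPolynomial (Fin m) ℂ), (v - ζ * u) = 0 := by
    rw [← hζ.pow_sub_pow_eq_prod_sub_mul v u hk, h, sub_self]
  obtain ⟨ζ, hζmem, hζ0⟩ := Finset.prod_eq_zero_iff.mp hprod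
  rw [Polynomial.mem_nthRootsFinset hk] at hζmem
  obtain ⟨c, -, rfl⟩ :=
    MvPolynomial.isUnit_iff_eq_C_of_isReduced.mp (IsUnit.of_pow_eq_one hζmem hk.ne')
  refine ⟨c, MvPolynomial.C_injective (Fin m) ℂ ?_, ?_⟩
  · rw [map_pow, map_one]
    exact hζmem
  · rw [smul_eq_C_mul]
    exact sub_eq_zero.mp hζ0

/-- A diagonal matrix acts on `X_1⋯X_m` by the product of its entries. [folklore] -/
private theorem linSubst_diagonal_prod_X (c : Fin m → ℂ) :
    linSubst (Fin m) ℂ (Matrix.diagonal c) (∏ i : Fin m, X i) =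
      (∏ i, c i) • ∏ i : Fin m, (X i : MvPolynomial (Fin m) ℂ) := by
  have hX : ∀ i, linSubst (Fin m) ℂ (Matrix.diagonal c) (X i) = C (c i) * X i := fun i => by
    rw [linSubst_X, Finset.sum_eq_single i (fun j _ hj => by
      rw [Matrix.diagonal_apply_ne _ hj, zero_smul]) (fun h => absurd (Finset.mem_univ i) h),
      Matrix.diagonal_apply_eq, smul_eq_C_mul]
  rw [map_prod]
  simp_rw [hX]
  rw [Finset.prod_mul_distrib, ← map_prod, smul_eq_C_mul]

/-- **`det(stab((X_1⋯X_m)^k)) = μ_k` for even `k ≥ 2`, `m ≥ 2`.** `⊆`: if `γ` fixes `uᵏ`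
(`u = X_1⋯X_m`) then `γ u = c u`, `cᵏ = 1`; with `tᵐ = c`, `(t·1)⁻¹ γ ∈ stab(u)`, whose determinants
are `±1` (Prop. 2.4 (1), `mem_stabilizerDetImage_prodX_iff`), so `det γ = ± c` and `(det γ)ᵏ = 1`
(`k` even). `⊇`: `diag(ξ, 1, …, 1)` maps `uᵏ` to `ξᵏ uᵏ`. (Ours; the `k = 1` statement is BI
Prop. 2.4 (1).) [cite: BurgisserIkenmeyer2017, Prop. 2.4 (1)] -/
theorem stabilizerDetImage_prod_X_pow {k : ℕ} (hm : 2 ≤ m) (hk : Even k) (hk0 : 0 < k) :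
    stabilizerDetImage ((∏ i : Fin m, X i) ^ k : MvPolynomial (Fin m) ℂ) = rootsOfUnity k ℂ := by
  classical
  have hm0 : 0 < m := by omega
  have huhom : (∏ i : Fin m, X i : MvPolynomial (Fin m) ℂ).IsHomogeneous m :=
    isHomogeneous_prod_X_fin m
  apply le_antisymm
  · rintro ξ hξ
    obtain ⟨γ, hγ, rfl⟩ := (mem_stabilizerDetImage_iff _ _).mp hξ
    rw [mem_linStabilizer, linSubstRep_apply, map_pow] at hγ
    obtain ⟨c, hck, hc⟩ := exists_smul_eq_of_pow_eq_pow hk0 hγ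
    have hc0 : c ≠ 0 := by
      rintro rfl
      rw [zero_pow hk0.ne'] at hck
      exact zero_ne_one hck
    obtain ⟨t, ht⟩ := IsAlgClosed.exists_pow_nat_eq c hm0
    have ht0 : t ≠ 0 := by
      rintro rfl
      rw [zero_pow hm0.ne'] at ht
      exact hc0 ht.symm
    -- `(t·1)⁻¹ γ` stabilizes `X_1⋯X_m`
    have hγ' : (Matrix.GeneralLinearGroup.scalar (Fin m) (Units.mk0 t ht0))⁻¹ * γ ∈
        linStabilizer (∏ i : Fin m, (X i : MvPolynomial (Fin m) ℂ)) := by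
      rw [mem_linStabilizer, map_mul, Module.End.mul_apply]
      simp only [linSubstRep_apply]
      rw [hc, map_smul, coe_scalarGL_inv ht0, linSubst_smul_one huhom, smul_smul, inv_pow, ht,
        mul_inv_cancel₀ hc0, one_smul]
    have hdet' := (mem_stabilizerDetImage_prodX_iff hm _).mp
      ((mem_stabilizerDetImage_iff _ _).mpr ⟨_, hγ', rfl⟩)
    have h1 : ((Matrix.GeneralLinearGroup.det γ : ℂˣ) : ℂ) = t ^ m *
        ((Matrix.GeneralLinearGroup.det
          ((Matrix.GeneralLinearGroup.scalar (Fin m) (Units.mk0 t ht0))⁻¹ * γ) : ℂˣ) : ℂ) := by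
      rw [map_mul, map_inv, Units.val_mul, Units.val_inv_eq_inv_val, val_det_scalarGL ht0,
        ← mul_assoc, mul_inv_cancel₀ (pow_ne_zero _ ht0), one_mul]
    have hdetγ : ((Matrix.GeneralLinearGroup.det γ : ℂˣ) : ℂ) ^ k = 1 := by
      rw [h1, ht, mul_pow, hck, one_mul]
      rcases hdet' with h | h <;> rw [h]
      · rw [Units.val_one, one_pow]
      · rw [Units.val_neg, Units.val_one, hk.neg_one_pow]
    rw [mem_rootsOfUnity]
    exact Units.ext (by rw [Units.val_pow_eq_pow_val, Units.val_one, hdetγ])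
  · intro ξ hξ
    rw [mem_rootsOfUnity] at hξ
    have hcprod : ∏ i : Fin m, (if i = (⟨0, hm0⟩ : Fin m) then ((ξ : ℂˣ) : ℂ) else 1) = ξ := by
      rw [Finset.prod_ite_eq', if_pos (Finset.mem_univ _)]
    have hdet : (Matrix.diagonal fun i : Fin m =>
        if i = (⟨0, hm0⟩ : Fin m) then ((ξ : ℂˣ) : ℂ) else 1).det ≠ 0 := by
      rw [Matrix.det_diagonal, hcprod]
      exact Units.ne_zero _
    refine (mem_stabilizerDetImage_iff _ _).mpr
      ⟨Matrix.GeneralLinearGroup.mkOfDetNeZero _ hdet, ?_, ?_⟩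
    · rw [mem_linStabilizer, linSubstRep_apply, Matrix.GeneralLinearGroup.val_mkOfDetNeZero, map_pow,
        linSubst_diagonal_prod_X, hcprod, smul_pow, ← Units.val_pow_eq_pow_val, hξ, Units.val_one,
        one_smul]
    · apply Units.ext
      rw [Matrix.GeneralLinearGroup.val_det_apply, Matrix.GeneralLinearGroup.val_mkOfDetNeZero,
        Matrix.det_diagonal, hcprod]

/-- **`a((X_1⋯X_m)^k) = k` for even `k ≥ 2` and `m ≥ 2`** (the `k = 1` value `a(X_1⋯X_m) = 2` is
BI Prop. 2.4 (1), `stabilizerPeriod_prodX`). [cite: BurgisserIkenmeyer2017, Prop. 2.4 (1)] -/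
theorem stabilizerPeriod_prod_X_pow {k : ℕ} (hm : 2 ≤ m) (hk : Even k) (hk0 : 0 < k) :
    stabilizerPeriod ((∏ i : Fin m, X i) ^ k : MvPolynomial (Fin m) ℂ) = k := by
  haveI : NeZero k := ⟨hk0.ne'⟩
  rw [stabilizerPeriod_def, stabilizerDetImage_prod_X_pow hm hk hk0]
  exact Complex.card_rootsOfUnity k

/-- `(X_1⋯X_m)^k` is a form of degree `k m`. [cite: BurgisserIkenmeyer2017, Prop. 2.4 (1)] -/
theorem isHomogeneous_prod_X_pow (m k : ℕ) :
    ((∏ i : Fin m, X i) ^ k : MvPolynomial (Fin m) ℂ).IsHomogeneous (k * m) := by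
  rw [mul_comm]
  exact (isHomogeneous_prod_X_fin m).pow k

/-- **`b((X_1⋯X_m)^k) = 1` in degree `D = k m`** (even `k ≥ 2`, `m ≥ 2`): eq. (3.1)
`D b = m a = m k`. [cite: BurgisserIkenmeyer2017, eq. (3.1)] -/
theorem degreePeriod_prod_X_pow {k : ℕ} (hm : 2 ≤ m) (hk : Even k) (hk0 : 0 < k) :
    degreePeriod (k * m) ((∏ i : Fin m, X i) ^ k : MvPolynomial (Fin m) ℂ) = 1 := by
  have hm0 : 0 < m := by omega
  have h := BI2017_eq_3_1 (isHomogeneous_prod_X_pow m k) (Nat.mul_pos hk0 hm0)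
  rw [stabilizerPeriod_prod_X_pow hm hk hk0, mul_comm m k] at h
  have h' : k * m * degreePeriod (k * m) ((∏ i : Fin m, X i) ^ k : MvPolynomial (Fin m) ℂ) =
      k * m * 1 := by rw [h, mul_one]
  exact Nat.eq_of_mul_eq_mul_left (Nat.mul_pos hk0 hm0) h'

/-- **Consecutive invariant degrees for the witness**: `q, q + 1 ∈ E((X_1⋯X_m)^k)` in degree
`D = k m` for some `q` (even `k ≥ 2`, `m ≥ 2`; Thm. 3.4 at the polystable witness, `b = 1`).
[cite: BurgisserIkenmeyer2017, Thm. 3.4] -/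
theorem exists_mem_degreeMonoid_succ_prod_X_pow {k : ℕ} (hm : 2 ≤ m) (hk : Even k) (hk0 : 0 < k) :
    ∃ q : ℕ, q ∈ degreeMonoid (k * m) ((∏ i : Fin m, X i) ^ k : MvPolynomial (Fin m) ℂ) ∧
      q + 1 ∈ degreeMonoid (k * m) ((∏ i : Fin m, X i) ^ k : MvPolynomial (Fin m) ℂ) := by
  have hm0 : 0 < m := by omega
  have hk2 : 2 ≤ k := by
    obtain ⟨j, rfl⟩ := hk
    omega
  have hD2 : 2 ≤ k * m := le_trans hk2 (Nat.le_mul_of_pos_right k hm0)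
  obtain ⟨q, hq, hq1⟩ := exists_mem_degreeMonoid_add_degreePeriod hD2 (isHomogeneous_prod_X_pow m k)
    (pow_ne_zero k (prod_X_fin_ne_zero m)) (isPolystable_prod_X_pow m k hk0)
  rw [degreePeriod_prod_X_pow hm hk hk0] at hq1
  exact ⟨q, hq, hq1⟩

end Witness

/-! ### Cor. 3.17 (2) at `(D, m) = (k m, m)`, `k` even, without Prop. 2.10 -/

section Assembly

variable {m D : ℕ}

/-- Exact semi-invariance: a homogeneous `SL_m`-invariant `F` of degree `d` with `F(w) ≠ 0` exhibits
`d / b(w) ∈ E'(w)` — here in the shape needed below: if `D d = m (a(w) e)` then `e ∈ E'(w)`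
(`F(g w) = det(g)^{a(w) e} F(w)`, BI Lemma 3.2 (1)). [cite: BurgisserIkenmeyer2017, Lemma 3.2 (1)] -/
theorem mem_exponentMonoid_of_aeval_ne_zero (hm : 0 < m) {f : MvPolynomial (Fin m) ℂ}
    (hf : f.IsHomogeneous D) {F : MvPolynomial (DegIdx (Fin m) D) ℂ} {d e : ℕ}
    (hFh : F.IsHomogeneous d) (hFi : IsSLInvariantCoord D F) (hFf : aeval (formCoeff D f) F ≠ 0)
    (hn : D * d = m * (stabilizerPeriod f * e)) : e ∈ exponentMonoid D f := by
  refine ⟨C (aeval (formCoeff D f) F)⁻¹ * F, fun g => ?_⟩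
  rw [map_mul, aeval_C, Algebra.algebraMap_self_apply,
    IsSLInvariantCoord.aeval_formCoeff_linSubstRep_eq_det_pow hm hf hFh hFi hn g, mul_left_comm,
    inv_mul_cancel₀ hFf, mul_one]

/-- **BI 2017, Cor. 3.17 (2) for `(D, m) = (k m, m)`, `k ≥ 2` even, `m ≥ 2` — PROVED WITHOUT
Prop. 2.10 / Popov.** (`D` is even and `gcd(D, m) = m > 1`, so these formats lie in the printed
range "if `D` is even and `gcd(D,m) > 1`".) If almost all `w ∈ Sym^D ℂ^m` have reduced stabilizer
period `a'(w) = 1`, then almost all `w` have a non-normal orbit closure `\overline{GL_m w}`.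
Proof (ours): the polystable witness `(X_1⋯X_m)^k` has `b = 1`, so (Thm. 3.4) `E(D,m) ∋ q, q+1` via
nonzero invariants `F_q, F_{q+1}` not vanishing at it; for `w` off `{F_q F_{q+1} = 0}` with
`a'(w) = 1` and `w ≠ 0`: `b(w) = 1`, `a(w) = k`, `q, q+1 ∈ E'(w)` (exact semi-invariance),
`1 ∉ E'(w)` (else `1 ∈ E(w) ⊆ E(D,m)`, contradicting `e(D,m) = m ≥ 2`, Cor. 3.16) and `q ≥ 1`; the
Reynolds-free core `not_isIntegrallyClosed_orbitCoordRing_of_consecutive` concludes.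
[cite: BurgisserIkenmeyer2017, Cor. 3.17 (2)] -/
theorem BI2017_cor_3_17_part2_of_mul_even (m k : ℕ) (hm : 2 ≤ m) (hk : Even k) (hk0 : 0 < k)
    (hgen : IsZariskiGeneric (k * m)
      (fun f : MvPolynomial (Fin m) ℂ => reducedStabilizerPeriod (k * m) f = 1)) :
    IsZariskiGeneric (k * m) fun f : MvPolynomial (Fin m) ℂ =>
      ¬ IsIntegrallyClosed (OrbitCoordRing f (k * m)) := by
  classical
  have hm0 : 0 < m := by omega
  have hD0 : 0 < k * m := Nat.mul_pos hk0 hm0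
  obtain ⟨q, ⟨F₁, hF₁h, hF₁i, hF₁I⟩, ⟨F₂, hF₂h, hF₂i, hF₂I⟩⟩ :=
    exists_mem_degreeMonoid_succ_prod_X_pow hm hk hk0
  have hF₁0 : F₁ ≠ 0 := by
    rintro rfl
    exact hF₁I (Ideal.zero_mem _)
  have hF₂0 : F₂ ≠ 0 := by
    rintro rfl
    exact hF₂I (Ideal.zero_mem _)
  -- the generic set: `F_q(w) F_{q+1}(w) ≠ 0`, `a'(w) = 1`, `w ≠ 0`
  have hG : IsZariskiGeneric (k * m) fun f : MvPolynomial (Fin m) ℂ =>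
      aeval (formCoeff (k * m) f) F₁ ≠ 0 ∧ aeval (formCoeff (k * m) f) F₂ ≠ 0 :=
    ⟨F₁ * F₂, mul_ne_zero hF₁0 hF₂0, fun f _ h => by
      rw [map_mul] at h
      exact ⟨left_ne_zero_of_mul h, right_ne_zero_of_mul h⟩⟩
  refine ((hG.and hgen).and (isZariskiGeneric_ne_zero hm0 (k * m))).mono fun f hf h => ?_
  obtain ⟨⟨⟨h₁, h₂⟩, ha'⟩, hf0⟩ := h
  -- `b(w) = 1` and `a(w) = k`
  have hb : degreePeriod (k * m) f = 1 := by
    rw [degreePeriod_eq_div_gcd_of_reducedStabilizerPeriod_eq_one hD0 hf ha',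
      Nat.gcd_eq_right (dvd_mul_left m k), Nat.div_self hm0]
  have ha : stabilizerPeriod f = k := by
    have h31 := BI2017_eq_3_1 hf hD0
    rw [hb, mul_one, mul_comm k m] at h31
    exact (Nat.eq_of_mul_eq_mul_left hm0 h31).symm
  -- `q, q + 1 ∈ E'(w)`
  have hqE : q ∈ exponentMonoid (k * m) f :=
    mem_exponentMonoid_of_aeval_ne_zero hm0 hf hF₁h hF₁i h₁ (by rw [ha]; ring)
  have hq1E : q + 1 ∈ exponentMonoid (k * m) f :=
    mem_exponentMonoid_of_aeval_ne_zero hm0 hf hF₂h hF₂i h₂ (by rw [ha]; ring)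
  -- `1 ∉ E'(w)`: otherwise `1 = b(w) · 1 ∈ E(w) ⊆ E(D,m)`, but `e(D,m) = m ≥ 2` (Cor. 3.16)
  have h1 : 1 ∉ exponentMonoid (k * m) f := by
    intro h1
    have hmem := mul_mem_degreeMonoid_of_mem_exponentMonoid hD0 hf hf0 h1
    rw [hb, mul_one] at hmem
    obtain ⟨F, hFh, hFi, hFI⟩ := hmem
    have hF0 : F ≠ 0 := by
      rintro rfl
      exact hFI (Ideal.zero_mem _)
    have hle : genericMinimalDegree (Fin m) ℂ (k * m) ≤ 1 := by
      unfold genericMinimalDegree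
      exact Nat.sInf_le ⟨⟨F, hFh, hFi, hF0⟩, Nat.one_pos⟩
    rw [BI2017_cor_3_16_holds (k * m) m (hk.mul_right m) hD0] at hle
    omega
  have hq0 : 0 < q := by
    rcases Nat.eq_zero_or_pos q with rfl | h
    · rw [zero_add] at hq1E
      exact absurd hq1E h1
    · exact h
  exact not_isIntegrallyClosed_orbitCoordRing_of_consecutive f hq0 hqE hq1E h1

/-- **Cor. 3.17 (2) for binary quartics, `(D, m) = (4, 2)`, without Prop. 2.10** (the first format of
the family; `gcd(4, 2) = 2 > 1`). [cite: BurgisserIkenmeyer2017, Cor. 3.17 (2)] -/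
theorem BI2017_cor_3_17_part2_four_two
    (hgen : IsZariskiGeneric 4 (fun f : MvPolynomial (Fin 2) ℂ => reducedStabilizerPeriod 4 f = 1)) :
    IsZariskiGeneric 4 fun f : MvPolynomial (Fin 2) ℂ => ¬ IsIntegrallyClosed (OrbitCoordRing f 4) :=
  BI2017_cor_3_17_part2_of_mul_even 2 2 le_rfl even_two two_pos hgen

/-- **Cor. 3.17 (2) in the shape of the named fact's second conjunct**, at `(D, m) = (k m, m)`,
`k ≥ 2` even, `m ≥ 2`: the printed hypotheses `2 ≤ D`, `2 ≤ m`, "`D` odd or `gcd(D,m) > 1`" are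
carried (the last two discharge automatically here). [cite: BurgisserIkenmeyer2017, Cor. 3.17 (2)] -/
theorem BI2017_cor_3_17_part2_clause_of_mul_even (m k : ℕ) (hm : 2 ≤ m) (hk : Even k)
    (hk0 : 0 < k) :
    2 ≤ k * m → 2 ≤ m →
      IsZariskiGeneric (k * m)
        (fun f : MvPolynomial (Fin m) ℂ => reducedStabilizerPeriod (k * m) f = 1) →
      (Odd (k * m) ∨ 1 < Nat.gcd (k * m) m) →
      IsZariskiGeneric (k * m) fun f : MvPolynomial (Fin m) ℂ =>
        ¬ IsIntegrallyClosed (OrbitCoordRing f (k * m)) :=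
  fun _ _ hgen _ => BI2017_cor_3_17_part2_of_mul_even m k hm hk hk0 hgen

end Assembly


/-! ### Generic stabilizer period `a(k m, m) = k` for even `k` (Thm. 2.3 on this range), and
Cor. 3.17 (2) at `(k m, m)` unconditionally -/

section GenericPeriod

variable {m : ℕ}

/-- **`μ_k ≤ det(stab w)` for EVERY form `w` of degree `k m` in `m ≥ 1` variables**: the scalar
matrices `ζ · 1` with `ζ^{km} = 1` stabilize `w` and have determinants `ζ^m`, which exhaust `μ_k`
(BI Lemma 2.1: the subgroup `{ζ^m : ζ^D = 1}` of order `D / gcd(D,m)`, here `= k`).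
[cite: BurgisserIkenmeyer2017, Lemma 2.1 (proof)] -/
theorem rootsOfUnity_le_stabilizerDetImage_of_degree_mul (hm : 0 < m) {k : ℕ}
    {w : MvPolynomial (Fin m) ℂ} (hw : w.IsHomogeneous (k * m)) :
    rootsOfUnity k ℂ ≤ stabilizerDetImage w := by
  intro u hu
  rw [mem_rootsOfUnity] at hu
  obtain ⟨z, hz⟩ := IsAlgClosed.exists_pow_nat_eq (u : ℂ) hm
  have hz0 : z ≠ 0 := by
    rintro rfl
    rw [zero_pow hm.ne'] at hz
    exact Units.ne_zero u hz.symm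
  have hζm : Units.mk0 z hz0 ^ m = u :=
    Units.ext (by rw [Units.val_pow_eq_pow_val, Units.val_mk0, hz])
  have hζD : Units.mk0 z hz0 ^ (k * m) = 1 := by rw [mul_comm, pow_mul, hζm, hu]
  rw [← hζm]
  exact pow_mem_stabilizerDetImage_of_pow_eq_one hw hζD

/-- **`det(stab w) ≤ μ_k`** for a form `w` of degree `k m` (`m ≥ 1`) at which two homogeneous
`SL_m`-invariants of consecutive degrees `q`, `q + 1` do not vanish: their weights along the orbit
are `det^{kq}` and `det^{k(q+1)}` (BI Lemma 3.2 (1), `stabilizerDetImage_le_rootsOfUnity_of_aeval_ne_zero`),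
and `μ_{kq} ∩ μ_{kq+k} ≤ μ_k`. [cite: BurgisserIkenmeyer2017, Lemma 3.2 (1) (proof)] -/
theorem stabilizerDetImage_le_rootsOfUnity_of_consecutive (hm : 0 < m) {k q : ℕ}
    {w : MvPolynomial (Fin m) ℂ} (hw : w.IsHomogeneous (k * m))
    {F₁ F₂ : MvPolynomial (DegIdx (Fin m) (k * m)) ℂ} (hF₁h : F₁.IsHomogeneous q)
    (hF₁i : IsSLInvariantCoord (k * m) F₁) (hF₁w : aeval (formCoeff (k * m) w) F₁ ≠ 0)
    (hF₂h : F₂.IsHomogeneous (q + 1)) (hF₂i : IsSLInvariantCoord (k * m) F₂)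
    (hF₂w : aeval (formCoeff (k * m) w) F₂ ≠ 0) :
    stabilizerDetImage w ≤ rootsOfUnity k ℂ := by
  have h₁ : stabilizerDetImage w ≤ rootsOfUnity (k * q) ℂ :=
    stabilizerDetImage_le_rootsOfUnity_of_aeval_ne_zero hm hw
      ((mem_slInvariantsOfDegree_iff _ _ F₁).mpr ⟨hF₁h, hF₁i⟩) (by ring) hF₁w
  have h₂ : stabilizerDetImage w ≤ rootsOfUnity (k * (q + 1)) ℂ :=
    stabilizerDetImage_le_rootsOfUnity_of_aeval_ne_zero hm hw
      ((mem_slInvariantsOfDegree_iff _ _ F₂).mpr ⟨hF₂h, hF₂i⟩) (by ring) hF₂w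
  intro u hu
  have hu₁ := h₁ hu
  have hu₂ := h₂ hu
  rw [mem_rootsOfUnity] at hu₁ hu₂ ⊢
  rw [mul_add, mul_one, pow_add, hu₁, one_mul] at hu₂
  exact hu₂

/-- **`a(w) = k` and `a'(w) = 1`** for a form `w` of degree `k m` (`k, m ≥ 1`) at which two
homogeneous `SL_m`-invariants of consecutive degrees do not vanish (`det(stab w) = μ_k`).
[cite: BurgisserIkenmeyer2017, Thm. 2.3] -/
theorem stabilizerPeriod_eq_of_consecutive (hm : 0 < m) {k q : ℕ} (hk0 : 0 < k)
    {w : MvPolynomial (Fin m) ℂ} (hw : w.IsHomogeneous (k * m))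
    {F₁ F₂ : MvPolynomial (DegIdx (Fin m) (k * m)) ℂ} (hF₁h : F₁.IsHomogeneous q)
    (hF₁i : IsSLInvariantCoord (k * m) F₁) (hF₁w : aeval (formCoeff (k * m) w) F₁ ≠ 0)
    (hF₂h : F₂.IsHomogeneous (q + 1)) (hF₂i : IsSLInvariantCoord (k * m) F₂)
    (hF₂w : aeval (formCoeff (k * m) w) F₂ ≠ 0) :
    stabilizerPeriod w = k ∧ reducedStabilizerPeriod (k * m) w = 1 := by
  haveI : NeZero k := ⟨hk0.ne'⟩
  have heq : stabilizerDetImage w = rootsOfUnity k ℂ :=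
    le_antisymm
      (stabilizerDetImage_le_rootsOfUnity_of_consecutive hm hw hF₁h hF₁i hF₁w hF₂h hF₂i hF₂w)
      (rootsOfUnity_le_stabilizerDetImage_of_degree_mul hm hw)
  have ha : stabilizerPeriod w = k := by
    rw [stabilizerPeriod_def, heq]
    exact Complex.card_rootsOfUnity k
  refine ⟨ha, ?_⟩
  rw [reducedStabilizerPeriod, ha, Fintype.card_fin, Nat.gcd_eq_right (dvd_mul_left m k),
    Nat.div_self (Nat.mul_pos hk0 hm)]

/-- **BI 2017, Thm. 2.3 (generic stabilizer period) ON THE RANGE `D = k m`, `k ≥ 2` even, `m ≥ 2`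
— PROVED**: almost all `w ∈ Sym^{km} ℂ^m` have stabilizer period `a(w) = k` (`= D / gcd(D,m)`) and
reduced period `a'(w) = 1`. Genericity polynomial: `F_q F_{q+1}` for the consecutive invariant
degrees `q, q+1 ∈ E(km, m)` supplied by the witness `(X_1⋯X_m)^k`
(`exists_mem_degreeMonoid_succ_prod_X_pow`). (The printed proof goes through Matsumura–Monsky's
generic trivial stabilizer; this invariant-theoretic route is ours.) [cite: BurgisserIkenmeyer2017, Thm. 2.3] -/
theorem isZariskiGeneric_period_of_mul_even (m k : ℕ) (hm : 2 ≤ m) (hk : Even k) (hk0 : 0 < k) :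
    IsZariskiGeneric (k * m) (fun f : MvPolynomial (Fin m) ℂ =>
      stabilizerPeriod f = k ∧ reducedStabilizerPeriod (k * m) f = 1) := by
  classical
  have hm0 : 0 < m := by omega
  obtain ⟨q, ⟨F₁, hF₁h, hF₁i, hF₁I⟩, ⟨F₂, hF₂h, hF₂i, hF₂I⟩⟩ :=
    exists_mem_degreeMonoid_succ_prod_X_pow hm hk hk0
  have hF₁0 : F₁ ≠ 0 := by
    rintro rfl
    exact hF₁I (Ideal.zero_mem _)
  have hF₂0 : F₂ ≠ 0 := by
    rintro rfl
    exact hF₂I (Ideal.zero_mem _)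
  refine ⟨F₁ * F₂, mul_ne_zero hF₁0 hF₂0, fun f hf h => ?_⟩
  rw [map_mul] at h
  exact stabilizerPeriod_eq_of_consecutive hm0 hk0 hf hF₁h hF₁i (left_ne_zero_of_mul h) hF₂h hF₂i
    (right_ne_zero_of_mul h)

/-- **Instances of the clause of `BI2017_thm_2_3_period`** (BI Thm. 2.3, second sentence, typed
verbatim and NOT consumable as a whole — erratum A21 at `(D,m) = (4,3)`) **on the range `D = k m`,
`k ≥ 2` even, `m ≥ 2`, PROVED**: here `D` is even and `m ∣ D`, so `(D,m) ∉ {(3,2), (3,3), (4,3)}`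
and the printed value is `a'(D,m) = 1`. [cite: BurgisserIkenmeyer2017, Thm. 2.3] -/
theorem BI2017_thm_2_3_period_of_mul_even (m k : ℕ) (hm : 2 ≤ m) (hk : Even k) (hk0 : 0 < k) :
    2 < k * m → 1 ≤ m →
      IsZariskiGeneric (k * m) fun f : MvPolynomial (Fin m) ℂ =>
        reducedStabilizerPeriod (k * m) f =
          if (k * m = 3 ∧ m = 2) ∨ (k * m = 3 ∧ m = 3) ∨ (k * m = 4 ∧ m = 3) then 2 else 1 := by
  intro _ _
  have h3 : k * m ≠ 3 := by
    intro h3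
    have hev : Even (k * m) := hk.mul_right m
    rw [h3] at hev
    exact absurd hev (by decide)
  have hne : ¬ ((k * m = 3 ∧ m = 2) ∨ (k * m = 3 ∧ m = 3) ∨ (k * m = 4 ∧ m = 3)) := by
    rintro (⟨h, -⟩ | ⟨h, -⟩ | ⟨h4, hm3⟩)
    · exact h3 h
    · exact h3 h
    · subst hm3
      omega
  rw [if_neg hne]
  exact (isZariskiGeneric_period_of_mul_even m k hm hk hk0).mono fun _ _ h => h.2

/-- **BI 2017, Cor. 3.17 (2) at `(D, m) = (k m, m)`, `k ≥ 2` even, `m ≥ 2` — UNCONDITIONALLY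
(no Prop. 2.10, no generic-stabilizer input): almost all forms of degree `k m` in `m` variables
have a NON-normal `GL_m`-orbit closure.** (`BI2017_cor_3_17_part2_of_mul_even` fed with
`isZariskiGeneric_period_of_mul_even`.) [cite: BurgisserIkenmeyer2017, Cor. 3.17 (2)] -/
theorem isZariskiGeneric_not_isIntegrallyClosed_of_mul_even (m k : ℕ) (hm : 2 ≤ m) (hk : Even k)
    (hk0 : 0 < k) :
    IsZariskiGeneric (k * m) fun f : MvPolynomial (Fin m) ℂ =>
      ¬ IsIntegrallyClosed (OrbitCoordRing f (k * m)) :=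
  BI2017_cor_3_17_part2_of_mul_even m k hm hk hk0
    ((isZariskiGeneric_period_of_mul_even m k hm hk hk0).mono fun _ _ h => h.2)

-- The first instance `(D, m) = (4, 2)` is already in the tree as `BI2017_cor_3_17_2_four_two`
-- (`BI17GenericBinaryQuarticNonNormal.lean`, via Prop. 2.10 at `(4,2)` and App. Prop. 7.4 (2)); not restated.

end GenericPeriod


/-! ### Witness-free form: generic period and non-normality from two invariant degrees -/

section TwoInvariantDegrees

variable {m D : ℕ}

/-- `D · (m / g) = m · (D / g)` for `g = gcd(D, m)`. [folklore] -/
private theorem mul_div_gcd_comm (D m : ℕ) :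
    D * (m / Nat.gcd D m) = m * (D / Nat.gcd D m) := by
  rw [← Nat.mul_div_assoc D (Nat.gcd_dvd_right D m), ← Nat.mul_div_assoc m (Nat.gcd_dvd_left D m),
    mul_comm]

/-- **`μ_{D/gcd(D,m)} ≤ det(stab w)` for EVERY form `w` of degree `D ≥ 1` in `m` variables**
(BI Lemma 2.1, proof: the determinants `ζ^m` of the scalar stabilizer elements `ζ · 1`, `ζ^D = 1`,
form the cyclic group of order `D / gcd(D,m)`; here via Bezout for the coprime pair
`(D/g, m/g)` and a `g`-th root). [cite: BurgisserIkenmeyer2017, Lemma 2.1 (proof)] -/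
theorem rootsOfUnity_div_gcd_le_stabilizerDetImage (hD : 0 < D)
    {w : MvPolynomial (Fin m) ℂ} (hw : w.IsHomogeneous D) :
    rootsOfUnity (D / Nat.gcd D m) ℂ ≤ stabilizerDetImage w := by
  set g := Nat.gcd D m with hg
  have hg0 : 0 < g := Nat.gcd_pos_of_pos_left _ hD
  have hgD : g ∣ D := Nat.gcd_dvd_left D m
  have hgm : g ∣ m := Nat.gcd_dvd_right D m
  have hk0 : 0 < D / g := Nat.div_pos (Nat.le_of_dvd hD hgD) hg0
  have hcop : Nat.Coprime (D / g) (m / g) := Nat.coprime_div_gcd_div_gcd hg0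
  intro u hu
  rw [mem_rootsOfUnity] at hu
  rcases Nat.lt_or_ge 1 (D / g) with hk1 | hk1
  · -- Bezout: `(m/g) a ≡ 1 (mod D/g)`; `ζ` a `g`-th root of `u^a`
    obtain ⟨a, -, ha⟩ := Nat.exists_mul_mod_eq_one_of_coprime hcop.symm hk1
    obtain ⟨z, hz⟩ := IsAlgClosed.exists_pow_nat_eq ((u ^ a : ℂˣ) : ℂ) hg0
    have hz0 : z ≠ 0 := by
      rintro rfl
      rw [zero_pow hg0.ne'] at hz
      exact Units.ne_zero _ hz.symm
    have hζg : Units.mk0 z hz0 ^ g = u ^ a :=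
      Units.ext (by rw [Units.val_pow_eq_pow_val, Units.val_mk0, hz])
    have hζD : Units.mk0 z hz0 ^ D = 1 := by
      rw [← Nat.div_mul_cancel hgD, mul_comm, pow_mul, hζg, ← pow_mul, mul_comm, pow_mul, hu, one_pow]
    have hζm : Units.mk0 z hz0 ^ m = u := by
      rw [← Nat.div_mul_cancel hgm, mul_comm, pow_mul, hζg, ← pow_mul, mul_comm a (m / g),
        ← Nat.div_add_mod (m / g * a) (D / g), pow_add, pow_mul, hu, one_pow, one_mul, ha, pow_one]
    rw [← hζm]
    exact pow_mem_stabilizerDetImage_of_pow_eq_one hw hζD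
  · have hk : D / g = 1 := le_antisymm hk1 hk0
    rw [hk, pow_one] at hu
    rw [hu]
    exact one_mem _

/-- **`det(stab w) ≤ μ_{D/gcd(D,m)}`** for a form `w` of degree `D` (`m ≥ 1`) at which two
homogeneous `SL_m`-invariants of degrees `(m/g) t` and `(m/g)(t+1)`, `g = gcd(D,m)`, do not vanish:
their weights along the orbit are `det^{(D/g) t}` and `det^{(D/g)(t+1)}` (Lemma 3.2 (1)), and
`μ_{kt} ∩ μ_{kt+k} ≤ μ_k`. [cite: BurgisserIkenmeyer2017, Lemma 3.2 (1) (proof)] -/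
theorem stabilizerDetImage_le_rootsOfUnity_div_gcd (hm : 0 < m) {t : ℕ}
    {w : MvPolynomial (Fin m) ℂ} (hw : w.IsHomogeneous D)
    {F₁ F₂ : MvPolynomial (DegIdx (Fin m) D) ℂ} (hF₁h : F₁.IsHomogeneous (m / Nat.gcd D m * t))
    (hF₁i : IsSLInvariantCoord D F₁) (hF₁w : aeval (formCoeff D w) F₁ ≠ 0)
    (hF₂h : F₂.IsHomogeneous (m / Nat.gcd D m * (t + 1))) (hF₂i : IsSLInvariantCoord D F₂)
    (hF₂w : aeval (formCoeff D w) F₂ ≠ 0) :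
    stabilizerDetImage w ≤ rootsOfUnity (D / Nat.gcd D m) ℂ := by
  have hn : ∀ s : ℕ, D * (m / Nat.gcd D m * s) = m * (D / Nat.gcd D m * s) := fun s => by
    rw [← mul_assoc, mul_div_gcd_comm D m, mul_assoc]
  have h₁ : stabilizerDetImage w ≤ rootsOfUnity (D / Nat.gcd D m * t) ℂ :=
    stabilizerDetImage_le_rootsOfUnity_of_aeval_ne_zero hm hw
      ((mem_slInvariantsOfDegree_iff _ _ F₁).mpr ⟨hF₁h, hF₁i⟩) (hn t) hF₁w
  have h₂ : stabilizerDetImage w ≤ rootsOfUnity (D / Nat.gcd D m * (t + 1)) ℂ :=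
    stabilizerDetImage_le_rootsOfUnity_of_aeval_ne_zero hm hw
      ((mem_slInvariantsOfDegree_iff _ _ F₂).mpr ⟨hF₂h, hF₂i⟩) (hn (t + 1)) hF₂w
  intro u hu
  have hu₁ := h₁ hu
  have hu₂ := h₂ hu
  rw [mem_rootsOfUnity] at hu₁ hu₂ ⊢
  rw [mul_add, mul_one, pow_add, hu₁, one_mul] at hu₂
  exact hu₂

/-- **`a(w) = D / gcd(D,m)` and `a'(w) = 1`** for a form `w` of degree `D ≥ 1` (`m ≥ 1`) at which
two homogeneous `SL_m`-invariants of degrees `(m/g) t`, `(m/g)(t+1)` do not vanish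
(`det(stab w) = μ_{D/g}`). [cite: BurgisserIkenmeyer2017, Thm. 2.3] -/
theorem stabilizerPeriod_eq_div_gcd_of_invariants (hD : 0 < D) (hm : 0 < m) {t : ℕ}
    {w : MvPolynomial (Fin m) ℂ} (hw : w.IsHomogeneous D)
    {F₁ F₂ : MvPolynomial (DegIdx (Fin m) D) ℂ} (hF₁h : F₁.IsHomogeneous (m / Nat.gcd D m * t))
    (hF₁i : IsSLInvariantCoord D F₁) (hF₁w : aeval (formCoeff D w) F₁ ≠ 0)
    (hF₂h : F₂.IsHomogeneous (m / Nat.gcd D m * (t + 1))) (hF₂i : IsSLInvariantCoord D F₂)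
    (hF₂w : aeval (formCoeff D w) F₂ ≠ 0) :
    stabilizerPeriod w = D / Nat.gcd D m ∧ reducedStabilizerPeriod D w = 1 := by
  have hg0 : 0 < Nat.gcd D m := Nat.gcd_pos_of_pos_left _ hD
  have hgD : Nat.gcd D m ∣ D := Nat.gcd_dvd_left D m
  have hk0 : 0 < D / Nat.gcd D m := Nat.div_pos (Nat.le_of_dvd hD hgD) hg0
  haveI : NeZero (D / Nat.gcd D m) := ⟨hk0.ne'⟩
  have heq : stabilizerDetImage w = rootsOfUnity (D / Nat.gcd D m) ℂ :=
    le_antisymm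
      (stabilizerDetImage_le_rootsOfUnity_div_gcd hm hw hF₁h hF₁i hF₁w hF₂h hF₂i hF₂w)
      (rootsOfUnity_div_gcd_le_stabilizerDetImage hD hw)
  have ha : stabilizerPeriod w = D / Nat.gcd D m := by
    rw [stabilizerPeriod_def, heq]
    exact Complex.card_rootsOfUnity _
  refine ⟨ha, ?_⟩
  rw [reducedStabilizerPeriod, ha, Fintype.card_fin, Nat.div_mul_cancel hgD, Nat.div_self hD]

/-- **BI 2017, Thm. 2.3's generic value `a(D,m) = D / gcd(D,m)`, `a'(D,m) = 1`, FROM TWO INVARIANT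
DEGREES** (`D, m ≥ 1`): if there are NONZERO homogeneous `SL_m`-invariants on `Sym^D ℂ^m` of degrees
`(m/g) t` and `(m/g)(t+1)` (`g = gcd(D,m)`), then almost all `w ∈ Sym^D ℂ^m` have `a(w) = D/g` and
`a'(w) = 1` (genericity polynomial `F_1 F_2`). (Ours; the printed Thm. 2.3 rests on Matsumura–Monsky.
Converse direction of record: for polystable generic `w` with `a'(w) = 1`, Thm. 3.4 gives that
`E(w)` generates `(m/g)ℤ`.) [cite: BurgisserIkenmeyer2017, Thm. 2.3] -/
theorem isZariskiGeneric_period_of_invariants (hD : 0 < D) (hm : 0 < m) {t : ℕ}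
    {F₁ F₂ : MvPolynomial (DegIdx (Fin m) D) ℂ} (hF₁h : F₁.IsHomogeneous (m / Nat.gcd D m * t))
    (hF₁i : IsSLInvariantCoord D F₁) (hF₁0 : F₁ ≠ 0)
    (hF₂h : F₂.IsHomogeneous (m / Nat.gcd D m * (t + 1))) (hF₂i : IsSLInvariantCoord D F₂)
    (hF₂0 : F₂ ≠ 0) :
    IsZariskiGeneric D (fun f : MvPolynomial (Fin m) ℂ =>
      stabilizerPeriod f = D / Nat.gcd D m ∧ reducedStabilizerPeriod D f = 1) := by
  refine ⟨F₁ * F₂, mul_ne_zero hF₁0 hF₂0, fun f hf h => ?_⟩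
  rw [map_mul] at h
  exact stabilizerPeriod_eq_div_gcd_of_invariants hD hm hf hF₁h hF₁i (left_ne_zero_of_mul h) hF₂h
    hF₂i (right_ne_zero_of_mul h)

/-- **BI 2017, Cor. 3.17 (2) REDUCED TO TWO INVARIANT DEGREES** (the witness-free form of this
file's route; no Prop. 2.10): let `D, m ≥ 2`, `g = gcd(D,m)`, and suppose `Sym^D ℂ^m` carries NONZERO
homogeneous `SL_m`-invariants `F_1, F_2` of degrees `(m/g) t` and `(m/g)(t+1)` for some `t`. If `D` is
odd or `g > 1`, then almost all `w ∈ Sym^D ℂ^m` have a NON-normal orbit closure. Proof: off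
`{F_1 F_2 = 0} ∪ {0}`: `a(w) = D/g`, `a'(w) = 1`, `b(w) = m/g`; `t, t+1 ∈ E'(w)` (weights
`det^{a(w) t}`, `det^{a(w)(t+1)}`); `1 ∉ E'(w)` — else `m/g = b(w) ∈ E(w)`, contradicting Howe's
`m ≤ d` for positive `d ∈ E(w)` (`g > 1`) resp. `m < d` for odd `D`; so `t ≥ 1` and the
Reynolds-free core applies. [cite: BurgisserIkenmeyer2017, Cor. 3.17 (2)] -/
theorem isZariskiGeneric_not_isIntegrallyClosed_of_invariants (hD : 2 ≤ D) (hm : 2 ≤ m) {t : ℕ}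
    {F₁ F₂ : MvPolynomial (DegIdx (Fin m) D) ℂ} (hF₁h : F₁.IsHomogeneous (m / Nat.gcd D m * t))
    (hF₁i : IsSLInvariantCoord D F₁) (hF₁0 : F₁ ≠ 0)
    (hF₂h : F₂.IsHomogeneous (m / Nat.gcd D m * (t + 1))) (hF₂i : IsSLInvariantCoord D F₂)
    (hF₂0 : F₂ ≠ 0) (hDm : Odd D ∨ 1 < Nat.gcd D m) :
    IsZariskiGeneric D fun f : MvPolynomial (Fin m) ℂ => ¬ IsIntegrallyClosed (OrbitCoordRing f D) := by
  classical
  have hD0 : 0 < D := by omega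
  have hm0 : 0 < m := by omega
  have hG : IsZariskiGeneric D fun f : MvPolynomial (Fin m) ℂ =>
      aeval (formCoeff D f) F₁ ≠ 0 ∧ aeval (formCoeff D f) F₂ ≠ 0 :=
    ⟨F₁ * F₂, mul_ne_zero hF₁0 hF₂0, fun f _ h => by
      rw [map_mul] at h
      exact ⟨left_ne_zero_of_mul h, right_ne_zero_of_mul h⟩⟩
  refine (hG.and (isZariskiGeneric_ne_zero hm0 D)).mono fun f hf h => ?_
  obtain ⟨⟨h₁, h₂⟩, hf0⟩ := h
  obtain ⟨ha, ha'⟩ :=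
    stabilizerPeriod_eq_div_gcd_of_invariants hD0 hm0 hf hF₁h hF₁i h₁ hF₂h hF₂i h₂
  have hb : degreePeriod D f = m / Nat.gcd D m :=
    degreePeriod_eq_div_gcd_of_reducedStabilizerPeriod_eq_one hD0 hf ha'
  have hn : ∀ s : ℕ, D * (m / Nat.gcd D m * s) = m * (stabilizerPeriod f * s) := fun s => by
    rw [ha, ← mul_assoc, mul_div_gcd_comm D m, mul_assoc]
  have htE : t ∈ exponentMonoid D f :=
    mem_exponentMonoid_of_aeval_ne_zero hm0 hf hF₁h hF₁i h₁ (hn t)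
  have ht1E : t + 1 ∈ exponentMonoid D f :=
    mem_exponentMonoid_of_aeval_ne_zero hm0 hf hF₂h hF₂i h₂ (hn (t + 1))
  -- `1 ∉ E'(w)`
  have h1 : 1 ∉ exponentMonoid D f := by
    intro h1
    have hmem := mul_mem_degreeMonoid_of_mem_exponentMonoid hD0 hf hf0 h1
    rw [hb, mul_one] at hmem
    have hg0 : 0 < Nat.gcd D m := Nat.gcd_pos_of_pos_left _ hD0
    have hgm : Nat.gcd D m ∣ m := Nat.gcd_dvd_right D m
    have hm'0 : 0 < m / Nat.gcd D m := Nat.div_pos (Nat.le_of_dvd hm0 hgm) hg0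
    have hle : m ≤ m / Nat.gcd D m := le_of_mem_degreeMonoid hD0 hmem hm'0
    rcases hDm with hodd | hg1
    · exact absurd (lt_of_mem_degreeMonoid_of_odd hm hodd hmem hm'0)
        (not_lt.mpr (Nat.div_le_self m _))
    · have hlt : m / Nat.gcd D m < m := Nat.div_lt_self hm0 hg1
      omega
  have ht0 : 0 < t := by
    rcases Nat.eq_zero_or_pos t with rfl | h
    · rw [zero_add] at ht1E
      exact absurd ht1E h1
    · exact h
  exact not_isIntegrallyClosed_orbitCoordRing_of_consecutive f ht0 htE ht1E h1

end TwoInvariantDegrees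

end Literature.Computability.AlgebraicComplexity

end
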